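import Mathlib
import HarnessLib

/-!
# Crux `DigitPolyUniformity` (stmt-QuantumAdvantage-1392), line `Sketch` (LAR composition):
# aligned blocks against all windows (the elementary transfer for Matomäki–Radziwiłł–Tao)

Stub `stub_window_average` (seat c5, wave 5, the Matomäki–Radziwiłł–Tao classes). The tree's
Matomäki–Radziwiłł–Tao Theorem 1.3 bounds the average over ALL integer left end-points `a` of the
window sums `V_a := Σ_{n ∈ [a, a+H)} c n` of a `1`-bounded sequence `c`; the crux needs the ALIGNED
blocks `[H y, H y + H)` only (a sparse set of left end-points). This file is the elementary
transfer: for `0 < T ≤ H` and `Y` blocks,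

  `Σ_{1 ≤ y < Y} ‖V_{Hy}‖ ≤ T⁻¹ Σ_{a=1}^{HY} ‖V_a‖ + T·Y`.

Proof. Sliding the window by one loses `c a` and gains `c (a + H)`, both of norm `≤ 1`, so the
window sums are `2`-Lipschitz in the left end-point (`WindowAverage.norm_window_succ_le`), whence
`‖V_{a+t}‖ ≤ ‖V_a‖ + 2t` (`WindowAverage.norm_window_add_le`). For `y ≥ 1` and `t < T ≤ H` this
gives `‖V_{Hy}‖ ≤ ‖V_{Hy−t}‖ + 2t`; summing over `t < T`,
`T‖V_{Hy}‖ ≤ Σ_{t<T} ‖V_{Hy−t}‖ + T(T−1) ≤ Σ_{t<T} ‖V_{Hy−t}‖ + T²` (`WindowAverage.key_step`,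
`WindowAverage.sum_range_two_mul_le`). Summing over `y ∈ [1, Y)`: the end-points `Hy − t`
(`t < T ≤ H`) are pairwise distinct (`WindowAverage.injOn_endpoint`) and lie in `[1, H·Y]`
(`WindowAverage.endpoint_mem_Icc`), so `Σ_y Σ_t ‖V_{Hy−t}‖ ≤ Σ_{a ∈ [1, HY]} ‖V_a‖` (nonnegative
terms; `Finset.sum_image` + `Finset.sum_le_sum_of_subset_of_nonneg`, `WindowAverage.sum_sum_le`),
and `(Y−1)T² ≤ T²Y`. Dividing by `T` gives the claim. Mathlib only; no named facts.
-/

noncomputable section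

namespace Summit.QuantumAdvantage.DigitPolyUniformity.SketchLAR

open Finset

namespace WindowAverage

/-- **Sliding the window by one.** `Σ_{[a+1, a+1+H)} c = Σ_{[a, a+H)} c + c (a+H) − c a`: both
sides are `Σ_{[a, a+H+1)} c − c a` (`Finset.sum_Ico_succ_top`, `Finset.sum_eq_sum_Ico_succ_bot`).
[folklore] -/
theorem window_succ (c : ℕ → ℂ) (H a : ℕ) :
    ∑ n ∈ Ico (a + 1) (a + 1 + H), c n = ∑ n ∈ Ico a (a + H), c n + c (a + H) - c a := by
  have h1 : ∑ n ∈ Ico a (a + H + 1), c n = ∑ n ∈ Ico a (a + H), c n + c (a + H) :=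
    Finset.sum_Ico_succ_top (Nat.le_add_right a H) c
  have h2 : ∑ n ∈ Ico a (a + H + 1), c n = c a + ∑ n ∈ Ico (a + 1) (a + H + 1), c n :=
    Finset.sum_eq_sum_Ico_succ_bot (by omega) c
  rw [show a + 1 + H = a + H + 1 by omega]
  linear_combination h1 - h2

/-- **The window sums are `2`-Lipschitz (one step).** For a `1`-bounded `c`,
`‖Σ_{[a+1, a+1+H)} c‖ ≤ ‖Σ_{[a, a+H)} c‖ + 2` (`window_succ` and the triangle inequality).
[folklore] -/
theorem norm_window_succ_le (c : ℕ → ℂ) (hc : ∀ n, ‖c n‖ ≤ 1) (H a : ℕ) :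
    ‖∑ n ∈ Ico (a + 1) (a + 1 + H), c n‖ ≤ ‖∑ n ∈ Ico a (a + H), c n‖ + 2 := by
  rw [window_succ]
  calc ‖∑ n ∈ Ico a (a + H), c n + c (a + H) - c a‖
      ≤ ‖∑ n ∈ Ico a (a + H), c n + c (a + H)‖ + ‖c a‖ := norm_sub_le _ _
    _ ≤ ‖∑ n ∈ Ico a (a + H), c n‖ + ‖c (a + H)‖ + ‖c a‖ := by
        gcongr
        exact norm_add_le _ _
    _ ≤ ‖∑ n ∈ Ico a (a + H), c n‖ + 1 + 1 := by
        gcongr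
        · exact hc _
        · exact hc _
    _ = ‖∑ n ∈ Ico a (a + H), c n‖ + 2 := by ring

/-- **The window sums are `2`-Lipschitz (`t` steps).** For a `1`-bounded `c`,
`‖Σ_{[a+t, a+t+H)} c‖ ≤ ‖Σ_{[a, a+H)} c‖ + 2t` (induction on `t` from `norm_window_succ_le`).
[folklore] -/
theorem norm_window_add_le (c : ℕ → ℂ) (hc : ∀ n, ‖c n‖ ≤ 1) (H a t : ℕ) :
    ‖∑ n ∈ Ico (a + t) (a + t + H), c n‖ ≤ ‖∑ n ∈ Ico a (a + H), c n‖ + 2 * (t : ℝ) := by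
  induction t with
  | zero => simp
  | succ t ih =>
    calc ‖∑ n ∈ Ico (a + (t + 1)) (a + (t + 1) + H), c n‖
        = ‖∑ n ∈ Ico (a + t + 1) (a + t + 1 + H), c n‖ := by rw [← add_assoc]
      _ ≤ ‖∑ n ∈ Ico (a + t) (a + t + H), c n‖ + 2 := norm_window_succ_le c hc H (a + t)
      _ ≤ ‖∑ n ∈ Ico a (a + H), c n‖ + 2 * (t : ℝ) + 2 := by linarith [ih]
      _ = ‖∑ n ∈ Ico a (a + H), c n‖ + 2 * ((t + 1 : ℕ) : ℝ) := by push_cast; ring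

/-- **Gauss bound.** `Σ_{t<T} 2t = T(T−1) ≤ T²` (induction on `T`). [folklore] -/
theorem sum_range_two_mul_le (T : ℕ) : ∑ t ∈ range T, 2 * (t : ℝ) ≤ (T : ℝ) * T := by
  induction T with
  | zero => simp
  | succ T ih =>
    rw [Finset.sum_range_succ]
    push_cast
    nlinarith [ih]

/-- **Averaging step at one aligned block.** For a `1`-bounded `c`, `T ≤ H` and `y ≥ 1`:
`T·‖V_{Hy}‖ ≤ Σ_{t<T} ‖V_{Hy−t}‖ + T²`, where `V_a = Σ_{[a, a+H)} c`
(`‖V_{Hy}‖ ≤ ‖V_{Hy−t}‖ + 2t` for `t < T ≤ H ≤ Hy` by `norm_window_add_le`, summed over `t < T`,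
plus `Σ_{t<T} 2t ≤ T²`, `sum_range_two_mul_le`). [folklore] -/
theorem key_step (c : ℕ → ℂ) (hc : ∀ n, ‖c n‖ ≤ 1) {H T y : ℕ} (hTH : T ≤ H) (hy : 1 ≤ y) :
    (T : ℝ) * ‖∑ n ∈ Ico (H * y) (H * y + H), c n‖ ≤
      ∑ t ∈ range T, ‖∑ n ∈ Ico (H * y - t) (H * y - t + H), c n‖ + (T : ℝ) * T := by
  have hHy : H ≤ H * y := Nat.le_mul_of_pos_right H hy
  have h1 : ∀ t ∈ range T, ‖∑ n ∈ Ico (H * y) (H * y + H), c n‖ ≤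
      ‖∑ n ∈ Ico (H * y - t) (H * y - t + H), c n‖ + 2 * (t : ℝ) := by
    intro t ht
    rw [mem_range] at ht
    have h := norm_window_add_le c hc H (H * y - t) t
    rwa [Nat.sub_add_cancel (by omega)] at h
  calc (T : ℝ) * ‖∑ n ∈ Ico (H * y) (H * y + H), c n‖
      = ∑ t ∈ range T, ‖∑ n ∈ Ico (H * y) (H * y + H), c n‖ := by
        rw [Finset.sum_const, Finset.card_range, nsmul_eq_mul]
    _ ≤ ∑ t ∈ range T, (‖∑ n ∈ Ico (H * y - t) (H * y - t + H), c n‖ + 2 * (t : ℝ)) :=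
        Finset.sum_le_sum h1
    _ = ∑ t ∈ range T, ‖∑ n ∈ Ico (H * y - t) (H * y - t + H), c n‖ +
          ∑ t ∈ range T, 2 * (t : ℝ) := Finset.sum_add_distrib
    _ ≤ ∑ t ∈ range T, ‖∑ n ∈ Ico (H * y - t) (H * y - t + H), c n‖ + (T : ℝ) * T := by
        gcongr
        exact sum_range_two_mul_le T

/-- **The end-points `Hy − t` are pairwise distinct.** On `[1, Y) × [0, T)` with `T ≤ H`, the map
`(y, t) ↦ Hy − t` is injective (`Hy − t ∈ (H(y−1), Hy]`, and these intervals are disjoint).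
[folklore] -/
theorem injOn_endpoint {H T Y : ℕ} (hTH : T ≤ H) :
    Set.InjOn (fun p : ℕ × ℕ => H * p.1 - p.2) ↑(Ico 1 Y ×ˢ range T) := by
  rintro ⟨y, t⟩ hp ⟨y', t'⟩ hq h
  simp only [Finset.mem_coe, Finset.mem_product, Finset.mem_Ico, Finset.mem_range] at hp hq
  simp only at h
  have h1 : H ≤ H * y := Nat.le_mul_of_pos_right H hp.1.1
  have h1' : H ≤ H * y' := Nat.le_mul_of_pos_right H hq.1.1
  rcases lt_trichotomy y y' with hlt | rfl | hgt
  · exfalso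
    have h3 : H * (y + 1) ≤ H * y' := Nat.mul_le_mul_left H hlt
    rw [Nat.mul_succ] at h3
    omega
  · rw [show t = t' by omega]
  · exfalso
    have h3 : H * (y' + 1) ≤ H * y := Nat.mul_le_mul_left H hgt
    rw [Nat.mul_succ] at h3
    omega

/-- **The end-points `Hy − t` lie in `[1, HY]`.** For `1 ≤ y < Y` and `t < T ≤ H`:
`1 ≤ H − t ≤ Hy − t ≤ Hy ≤ HY`. [folklore] -/
theorem endpoint_mem_Icc {H T Y : ℕ} (hTH : T ≤ H) {p : ℕ × ℕ} (hp : p ∈ Ico 1 Y ×ˢ range T) :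
    H * p.1 - p.2 ∈ Icc 1 (H * Y) := by
  obtain ⟨y, t⟩ := p
  simp only [Finset.mem_product, Finset.mem_Ico, Finset.mem_range] at hp
  rw [Finset.mem_Icc]
  have h1 : H ≤ H * y := Nat.le_mul_of_pos_right H hp.1.1
  have h2 : H * y ≤ H * Y := Nat.mul_le_mul_left H hp.1.2.le
  simp only
  omega

/-- **Reindexing the double sum.** For a nonnegative `F` and `T ≤ H`,
`Σ_{1 ≤ y < Y} Σ_{t < T} F (Hy − t) ≤ Σ_{a ∈ [1, HY]} F a`: the double sum is the sum of `F` over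
the image of the injective map `(y, t) ↦ Hy − t` (`injOn_endpoint`, `Finset.sum_image`), a subset
of `[1, HY]` (`endpoint_mem_Icc`), and the remaining terms are nonnegative
(`Finset.sum_le_sum_of_subset_of_nonneg`). [folklore] -/
theorem sum_sum_le (F : ℕ → ℝ) (hF : ∀ a, 0 ≤ F a) {H T Y : ℕ} (hTH : T ≤ H) :
    ∑ y ∈ Ico 1 Y, ∑ t ∈ range T, F (H * y - t) ≤ ∑ a ∈ Icc 1 (H * Y), F a := by
  have hsub : (Ico 1 Y ×ˢ range T).image (fun p : ℕ × ℕ => H * p.1 - p.2) ⊆ Icc 1 (H * Y) := by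
    intro a ha
    rw [Finset.mem_image] at ha
    obtain ⟨p, hp, rfl⟩ := ha
    exact endpoint_mem_Icc hTH hp
  calc ∑ y ∈ Ico 1 Y, ∑ t ∈ range T, F (H * y - t)
      = ∑ p ∈ Ico 1 Y ×ˢ range T, F (H * p.1 - p.2) :=
        (Finset.sum_product' (Ico 1 Y) (range T) fun y t => F (H * y - t)).symm
    _ = ∑ a ∈ (Ico 1 Y ×ˢ range T).image (fun p : ℕ × ℕ => H * p.1 - p.2), F a :=
        (Finset.sum_image (injOn_endpoint hTH)).symm
    _ ≤ ∑ a ∈ Icc 1 (H * Y), F a :=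
        Finset.sum_le_sum_of_subset_of_nonneg hsub fun a _ _ => hF a

end WindowAverage

/-- **Stub (c5/S2b): aligned blocks against all windows.** For a `1`-bounded sequence `c`, block
length `H`, an averaging length `0 < T ≤ H` and `Y` blocks:
`Σ_{1 ≤ y < Y} ‖Σ_{[Hy, Hy+H)} c‖ ≤ T⁻¹ Σ_{a=1}^{HY} ‖Σ_{[a,a+H)} c‖ + T·Y`
(the window sums are `2`-Lipschitz in the left end-point, so `‖V_{Hy}‖ ≤ ‖V_{Hy−t}‖ + 2t` for
`t < T`, summed over `t < T` (`WindowAverage.key_step`); the end-points `Hy − t` are distinct in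
`[1, HY]` (`WindowAverage.sum_sum_le`); `(Y−1)T² ≤ T²Y`; then divide by `T`). [folklore] -/
theorem stub_window_average (c : ℕ → ℂ) (hc : ∀ n, ‖c n‖ ≤ 1) {H T Y : ℕ} (hT : 0 < T) (hTH : T ≤ H) :
    ∑ y ∈ Ico 1 Y, ‖∑ n ∈ Ico (H * y) (H * y + H), c n‖ ≤
      (1 / (T : ℝ)) * ∑ a ∈ Icc 1 (H * Y), ‖∑ n ∈ Ico a (a + H), c n‖ + (T : ℝ) * Y := by
  have hT' : (0 : ℝ) < T := by exact_mod_cast hT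
  -- `T · LHS ≤ S + T²·Y`
  have step : (T : ℝ) * ∑ y ∈ Ico 1 Y, ‖∑ n ∈ Ico (H * y) (H * y + H), c n‖ ≤
      ∑ a ∈ Icc 1 (H * Y), ‖∑ n ∈ Ico a (a + H), c n‖ + (T : ℝ) * T * Y := by
    rw [Finset.mul_sum]
    calc ∑ y ∈ Ico 1 Y, (T : ℝ) * ‖∑ n ∈ Ico (H * y) (H * y + H), c n‖
        ≤ ∑ y ∈ Ico 1 Y,
            (∑ t ∈ range T, ‖∑ n ∈ Ico (H * y - t) (H * y - t + H), c n‖ + (T : ℝ) * T) :=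
          Finset.sum_le_sum fun y hy => WindowAverage.key_step c hc hTH (mem_Ico.mp hy).1
      _ = ∑ y ∈ Ico 1 Y, ∑ t ∈ range T, ‖∑ n ∈ Ico (H * y - t) (H * y - t + H), c n‖ +
            ∑ y ∈ Ico 1 Y, (T : ℝ) * T := Finset.sum_add_distrib
      _ ≤ ∑ a ∈ Icc 1 (H * Y), ‖∑ n ∈ Ico a (a + H), c n‖ + (T : ℝ) * T * Y := by
          gcongr
          · exact WindowAverage.sum_sum_le (fun a => ‖∑ n ∈ Ico a (a + H), c n‖)
              (fun a => norm_nonneg _) hTH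
          · rw [Finset.sum_const, Nat.card_Ico, nsmul_eq_mul]
            have hY : ((Y - 1 : ℕ) : ℝ) ≤ Y := by exact_mod_cast Nat.sub_le Y 1
            have hTT : (0 : ℝ) ≤ (T : ℝ) * T := by positivity
            nlinarith [hY, hTT]
  have h2 : ∑ y ∈ Ico 1 Y, ‖∑ n ∈ Ico (H * y) (H * y + H), c n‖ ≤
      (∑ a ∈ Icc 1 (H * Y), ‖∑ n ∈ Ico a (a + H), c n‖ + (T : ℝ) * T * Y) / T := by
    rw [le_div_iff₀ hT']
    linarith [step]
  calc ∑ y ∈ Ico 1 Y, ‖∑ n ∈ Ico (H * y) (H * y + H), c n‖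
      ≤ (∑ a ∈ Icc 1 (H * Y), ‖∑ n ∈ Ico a (a + H), c n‖ + (T : ℝ) * T * Y) / T := h2
    _ = (1 / (T : ℝ)) * ∑ a ∈ Icc 1 (H * Y), ‖∑ n ∈ Ico a (a + H), c n‖ + (T : ℝ) * Y := by
        have hT0 : (T : ℝ) ≠ 0 := hT'.ne'
        field_simp

end Summit.QuantumAdvantage.DigitPolyUniformity.SketchLAR

end
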